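/-
Copyright (c) 2026. All rights reserved.
Released under Apache 2.0 license as described in the file LICENSE.
-/
import Literature.Probability.FitznerVanDerHofstad2017.SrwTrigMajorantEncl
import Literature.Probability.FitznerVanDerHofstad2017.SrwTwistWeightClasses
import Literature.Probability.FitznerVanDerHofstad2017.SrwIntegralM2Bounds
import HarnessLib

/-!
# The second-moment (`Shi`) inputs of the `K_{n,2}`, `U_{n,0}`, `U_{n,2}`, `KM₂` rows as plain seeds

Support module (d-generic, number-free, definition-free).  The trigonometric-majorant rows
(`srw{K,U,KM2}_le_gset_encl_cast` of `SrwTrigMajorantEncl`, and the class rows built on them) take ONE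
rational bound `Shi` on the second moment `Sq^{w}_n(x) = ∫ w (D̂^{(x)})² Ĉⁿ` of the row weight `w`.  This
module supplies that input, for the axis nodes `x = m e_i`, as explicit combinations of PLAIN SEEDS
`I_{n,l}(x₀)` (`l = 0, 2`) at the three nodes `0`, `2m e_i`, `m e_i + m e_j`, in real and `ℚ`-cast forms:

* `K`-weights `|D̂|²`, `|D̂|⁰` (exact: `srwSqMom_abs_Dhat_pow_even_single_eq` of `SrwTrigMajorantEncl`) —
  cast corollaries `srwSqMom_abs_Dhat_sq_single_le_cast`, `srwSqMom_one_single_le_cast`;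
* `U`-weights `|D̂|^l D̂^{sin}` (`Sq ≤ d⁻¹ Sq^{|D̂|^l}`, `SrwTwistWeightClasses`) — `srwSqMom_abs_Dhat_pow_zero_mul_Dsin_single_le(_cast)`,
  `srwSqMom_abs_Dhat_sq_mul_Dsin_single_le(_cast)`;
* the `KM₂` weight `|D̂|⁰ M̂²` — NEW here: from `M̂² Ĉⁿ ≤ D̂² Ĉⁿ + 4 D̂^{sin} Ĉⁿ − 4(1 − 2/d) D̂^{sin} Ĉⁿ⁺¹`
  a.e. (`Mhat_sq_mul_Chat_pow_le`), the weight comparison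
  `Sq^{|D̂|⁰M̂²}_n(x) ≤ Sq^{|D̂|²}_n(x) + 4 Sq^{|D̂|⁰D̂^{sin}}_n(x) − (4 − 8/d) Sq^{|D̂|⁰D̂^{sin}}_{n+1}(x)`
  (`srwSqMom_Mhat_sq_le_sub`, `d ≥ 2n+1`), its corollary
  `Sq^{|D̂|⁰M̂²}_n(x) ≤ Sq^{|D̂|²}_n(x) + (4/d) Sq^{1}_n(x)` (`srwSqMom_Mhat_sq_le`, `d ≥ 2`) and the seed forms
  `srwSqMom_Mhat_sq_single_le(_of_le)(_cast)`.

The m-uniform forms (`_of_le`: every `|m| ≥ M`, seeds at `M`) use the coordinatewise monotonicity of the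
seeds (`absMonotone_srwI`, `n ≥ 1`).  All statements are exact bookkeeping for general `d`; nothing here is
numerical and nothing is a certificate.  No dimension-specific declaration is introduced.

References: [FvdH17] R. Fitzner, R. van der Hofstad, *Mean-field behavior for nearest-neighbor
percolation in `d > 10`*, Electron. J. Probab. 22 (2017) no. 43 and the NoBLE companion PTRF 169 (2017)
1041–1119, (3.26) p. 1070, (3.34)–(3.38) p. 1071, §5.2 (5.4), (5.7), (5.9), (5.10) pp. 1091–1092,
Lemma 5.1 p. 1093.
-/

noncomputable section

open MeasureTheory Real Finset
open scoped BigOperators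

namespace Literature.Probability.FitznerVanDerHofstad2017

open Literature.Barriers.CriticalPhenomena
open Literature.Barriers.CriticalPhenomena.Slade2006Prop53 (P)

variable {d : ℕ}

/-! ### The `KM₂` weight against the `K`- and `U`-weights -/

/-- Two distinct coordinates force `d ≥ 2`. [folklore] -/
private theorem two_le_of_ne {i j : Fin d} (hij : i ≠ j) : 2 ≤ d := by
  by_contra h
  push Not at h
  haveI : Subsingleton (Fin d) := Fin.subsingleton_iff_le_one.mpr (by omega)
  exact hij (Subsingleton.elim _ _)

/-- The `U_{n+1}`-type second-moment integrand `D̂^{sin} (D̂^{(x)})² Ĉⁿ⁺¹` is integrable already for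
`d ≥ 2n+1` (`D̂^{sin} Ĉ ≤ 2/d` is bounded). [cite: HeydenreichVanDerHofstad2017, Prop. 5.5] -/
private theorem integrable_Dsin_sq_mul_Chat_pow_succ {n : ℕ} (hd : 2 * n + 1 ≤ d) (x : Fin d → ℤ) :
    Integrable (fun k => ((|Dhat d k| ^ 0 * Dsin d k) * DhatSym d x k ^ 2) * Chat d 1 k ^ (n + 1)) (P d) := by
  have hd1 : 1 ≤ d := by omega
  have h := integrable_weight_sq_mul_Chat_pow hd (w := fun k => Dsin d k * Chat d 1 k)
    ((continuous_Dsin d).measurable.mul (measurable_Chat_one d)) (W := 2 / d)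
    (fun k => by
      rw [abs_of_nonneg (mul_nonneg (Dsin_nonneg k) (Chat_one_nonneg k))]
      exact Dsin_mul_Chat_le hd1 k) x
  refine h.congr (ae_of_all _ fun k => ?_)
  simp only [pow_zero, one_mul]
  ring

/-- The pointwise comparison behind `srwSqMom_Mhat_sq_le_sub`, where `Ĉ (1 − D̂) = 1`.
[cite: FitznerVanDerHofstad2016NoBLE, (3.26) p. 1070; §5.2 (5.10) p. 1092] -/
private theorem KM2_sq_integrand_le (hd : 1 ≤ d) (n : ℕ) (x : Fin d → ℤ) (k : Fin d → ℝ)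
    (hk : Chat d 1 k * (1 - Dhat d k) = 1) :
    ((|Dhat d k| ^ 0 * Mhat d k ^ 2) * DhatSym d x k ^ 2) * Chat d 1 k ^ n
      ≤ (|Dhat d k| ^ 2 * DhatSym d x k ^ 2) * Chat d 1 k ^ n
        + 4 * (((|Dhat d k| ^ 0 * Dsin d k) * DhatSym d x k ^ 2) * Chat d 1 k ^ n)
        - (4 - 8 / d) * (((|Dhat d k| ^ 0 * Dsin d k) * DhatSym d x k ^ 2) * Chat d 1 k ^ (n + 1)) := by
  have h := mul_le_mul_of_nonneg_left (Mhat_sq_mul_Chat_pow_le hd n k hk) (sq_nonneg (DhatSym d x k))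
  rw [sq_abs, pow_zero, one_mul, one_mul]
  calc (Mhat d k ^ 2 * DhatSym d x k ^ 2) * Chat d 1 k ^ n
      = DhatSym d x k ^ 2 * (Mhat d k ^ 2 * Chat d 1 k ^ n) := by ring
    _ ≤ DhatSym d x k ^ 2 * (Dhat d k ^ 2 * Chat d 1 k ^ n + 4 * (Dsin d k * Chat d 1 k ^ n)
          - 4 * (1 - 2 / d) * (Dsin d k * Chat d 1 k ^ (n + 1))) := h
    _ = _ := by ring

/-- **The `KM₂` weight against the `K`- and `U`-weights:**
`Sq^{|D̂|⁰M̂²}_n(x) ≤ Sq^{|D̂|²}_n(x) + 4 Sq^{|D̂|⁰D̂^{sin}}_n(x) − (4 − 8/d) Sq^{|D̂|⁰D̂^{sin}}_{n+1}(x)`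
(`d ≥ 2n+1`; from `M̂² Ĉⁿ ≤ D̂² Ĉⁿ + 4 D̂^{sin} Ĉⁿ − 4(1 − 2/d) D̂^{sin} Ĉⁿ⁺¹` where `Ĉ(1 − D̂) = 1`, i.e.
almost everywhere, times `(D̂^{(x)})² ≥ 0`).
[cite: FitznerVanDerHofstad2016NoBLE, (3.26) p. 1070, (3.34)–(3.37) p. 1071; §5.2 (5.9)–(5.10) p. 1092] -/
theorem srwSqMom_Mhat_sq_le_sub {n : ℕ} (hd : 2 * n + 1 ≤ d) (x : Fin d → ℤ) :
    srwSqMom d n (fun k => |Dhat d k| ^ 0 * Mhat d k ^ 2) x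
      ≤ srwSqMom d n (fun k => |Dhat d k| ^ 2) x
        + 4 * srwSqMom d n (fun k => |Dhat d k| ^ 0 * Dsin d k) x
        - (4 - 8 / d) * srwSqMom d (n + 1) (fun k => |Dhat d k| ^ 0 * Dsin d k) x := by
  have hd1 : 1 ≤ d := by omega
  have iA := integrable_KM2weight_sq_mul_Chat_pow hd 0 x
  have iB : Integrable (fun k => (|Dhat d k| ^ 2 * DhatSym d x k ^ 2) * Chat d 1 k ^ n) (P d) :=
    integrable_weight_sq_mul_Chat_pow hd ((continuous_Dhat d).measurable.abs.pow_const 2)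
      (fun k => by rw [abs_of_nonneg (pow_nonneg (abs_nonneg _) 2)]; exact abs_Dhat_pow_le_one 2 k) x
  have iC : Integrable (fun k => ((|Dhat d k| ^ 0 * Dsin d k) * DhatSym d x k ^ 2) * Chat d 1 k ^ n) (P d) :=
    integrable_weight_sq_mul_Chat_pow hd (w := fun k => |Dhat d k| ^ 0 * Dsin d k)
      (((continuous_Dhat d).measurable.abs.pow_const 0).mul (continuous_Dsin d).measurable) (W := 1 / d)
      (fun k => by
        rw [pow_zero, one_mul, abs_of_nonneg (Dsin_nonneg k)]
        exact Dsin_le_inv hd1 k) x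
  have iD := integrable_Dsin_sq_mul_Chat_pow_succ hd x
  have iBC : Integrable (fun k => (|Dhat d k| ^ 2 * DhatSym d x k ^ 2) * Chat d 1 k ^ n
      + 4 * (((|Dhat d k| ^ 0 * Dsin d k) * DhatSym d x k ^ 2) * Chat d 1 k ^ n)) (P d) :=
    iB.add (iC.const_mul 4)
  have iD' : Integrable (fun k =>
      (4 - 8 / d) * (((|Dhat d k| ^ 0 * Dsin d k) * DhatSym d x k ^ 2) * Chat d 1 k ^ (n + 1))) (P d) :=
    iD.const_mul _
  have step : ∫ k, ((|Dhat d k| ^ 0 * Mhat d k ^ 2) * DhatSym d x k ^ 2) * Chat d 1 k ^ n ∂P d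
      ≤ ∫ k, ((|Dhat d k| ^ 2 * DhatSym d x k ^ 2) * Chat d 1 k ^ n
          + 4 * (((|Dhat d k| ^ 0 * Dsin d k) * DhatSym d x k ^ 2) * Chat d 1 k ^ n)
          - (4 - 8 / d) * (((|Dhat d k| ^ 0 * Dsin d k) * DhatSym d x k ^ 2) * Chat d 1 k ^ (n + 1))) ∂P d :=
    integral_mono_ae iA (iBC.sub iD') ((ae_Chat_mul_one_sub_Dhat hd1).mono fun k hk =>
      KM2_sq_integrand_le hd1 n x k hk)
  have e : ∫ k, ((|Dhat d k| ^ 2 * DhatSym d x k ^ 2) * Chat d 1 k ^ n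
          + 4 * (((|Dhat d k| ^ 0 * Dsin d k) * DhatSym d x k ^ 2) * Chat d 1 k ^ n)
          - (4 - 8 / d) * (((|Dhat d k| ^ 0 * Dsin d k) * DhatSym d x k ^ 2) * Chat d 1 k ^ (n + 1))) ∂P d
      = (∫ k, (|Dhat d k| ^ 2 * DhatSym d x k ^ 2) * Chat d 1 k ^ n ∂P d)
        + 4 * (∫ k, ((|Dhat d k| ^ 0 * Dsin d k) * DhatSym d x k ^ 2) * Chat d 1 k ^ n ∂P d)
        - (4 - 8 / d)
          * (∫ k, ((|Dhat d k| ^ 0 * Dsin d k) * DhatSym d x k ^ 2) * Chat d 1 k ^ (n + 1) ∂P d) := by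
    rw [integral_sub iBC iD', integral_add iB (iC.const_mul 4), integral_const_mul, integral_const_mul]
  rw [e] at step
  have hpos : (0 : ℝ) < (2 * π) ^ d := by positivity
  simp only [srwSqMom]
  calc (∫ k, ((|Dhat d k| ^ 0 * Mhat d k ^ 2) * DhatSym d x k ^ 2) * Chat d 1 k ^ n ∂P d) / (2 * π) ^ d
      ≤ ((∫ k, (|Dhat d k| ^ 2 * DhatSym d x k ^ 2) * Chat d 1 k ^ n ∂P d)
        + 4 * (∫ k, ((|Dhat d k| ^ 0 * Dsin d k) * DhatSym d x k ^ 2) * Chat d 1 k ^ n ∂P d)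
        - (4 - 8 / d)
          * (∫ k, ((|Dhat d k| ^ 0 * Dsin d k) * DhatSym d x k ^ 2) * Chat d 1 k ^ (n + 1) ∂P d))
          / (2 * π) ^ d := div_le_div_of_nonneg_right step hpos.le
    _ = _ := by ring

/-- The second moment under a nonnegative-type weight `|D̂|⁰D̂^{sin}` is nonnegative (order `n+1`, `d ≥ 2n+1`).
[cite: FitznerVanDerHofstad2016NoBLE, (3.34) p. 1071, (5.7) p. 1091] -/
theorem srwSqMom_abs_Dhat_pow_zero_mul_Dsin_succ_nonneg (n : ℕ) (x : Fin d → ℤ) :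
    0 ≤ srwSqMom d (n + 1) (fun k => |Dhat d k| ^ 0 * Dsin d k) x := by
  unfold srwSqMom
  refine div_nonneg (integral_nonneg fun k => ?_) (by positivity)
  exact mul_nonneg (mul_nonneg (mul_nonneg (pow_nonneg (abs_nonneg _) 0) (Dsin_nonneg k)) (sq_nonneg _))
    (pow_nonneg (Chat_one_nonneg k) _)

/-- **`Sq^{|D̂|⁰M̂²}_n(x) ≤ Sq^{|D̂|²}_n(x) + (4/d) · Sq^{1}_n(x)`** (`d ≥ 2n+1`, `d ≥ 2`: drop the subtracted
`U_{n+1}`-term of `srwSqMom_Mhat_sq_le_sub` and use `Sq^{|D̂|⁰D̂^{sin}}_n ≤ d⁻¹ Sq^{|D̂|⁰}_n = d⁻¹ Sq^{1}_n`).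
[cite: FitznerVanDerHofstad2016NoBLE, (3.34)–(3.37) p. 1071; §5.2 (5.7), (5.9)–(5.10) pp. 1091–1092] -/
theorem srwSqMom_Mhat_sq_le {n : ℕ} (hd : 2 * n + 1 ≤ d) (hd2 : 2 ≤ d) (x : Fin d → ℤ) :
    srwSqMom d n (fun k => |Dhat d k| ^ 0 * Mhat d k ^ 2) x
      ≤ srwSqMom d n (fun k => |Dhat d k| ^ 2) x + 4 / d * srwSqMom d n (fun _ => (1 : ℝ)) x := by
  have h := srwSqMom_Mhat_sq_le_sub hd x
  have hU := srwSqMom_abs_Dhat_pow_mul_Dsin_le hd 0 x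
  rw [srwSqMom_abs_Dhat_pow_zero] at hU
  have hpos := srwSqMom_abs_Dhat_pow_zero_mul_Dsin_succ_nonneg (d := d) n x
  have hc : (0 : ℝ) ≤ 4 - 8 / d := by
    have hd' : (2 : ℝ) ≤ d := by exact_mod_cast hd2
    have : (8 : ℝ) / d ≤ 4 := by rw [div_le_iff₀ (by linarith)]; linarith
    linarith
  have hd0 : (0 : ℝ) < d := by exact_mod_cast (show 0 < d by omega)
  have e : 4 / (d : ℝ) * srwSqMom d n (fun _ => (1 : ℝ)) x = 4 * (1 / d * srwSqMom d n (fun _ => (1 : ℝ)) x) := by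
    ring
  rw [e]
  nlinarith [mul_nonneg hc hpos]

/-! ### The `K`- and `U`-row inputs at the axis nodes `x = m e_i` as plain seeds -/

/-- `Sq^{|D̂|²}_n(m e_i) = (I_{n,2}(0) + I_{n,2}(2m e_i))/(2d) + ((d−1)/d) I_{n,2}(m e_i + m e_j)` (`i ≠ j`).
[cite: FitznerVanDerHofstad2016NoBLE, (3.34) p. 1071; (5.4), (5.7) p. 1091] -/
theorem srwSqMom_abs_Dhat_sq_single_eq {n : ℕ} (hd : 2 * n + 1 ≤ d) {i j : Fin d} (hij : i ≠ j) (m : ℤ) :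
    srwSqMom d n (fun k => |Dhat d k| ^ 2) (Pi.single i m)
      = (srwI d n 2 0 + srwI d n 2 (Pi.single i (2 * m))) / (2 * d)
        + ((d : ℝ) - 1) / d * srwI d n 2 (Pi.single i m + Pi.single j m) := by
  have h := srwSqMom_abs_Dhat_pow_even_single_eq hd 1 hij m
  simpa only [mul_one] using h

/-- `Sq^{1}_n(m e_i) = (I_{n,0}(0) + I_{n,0}(2m e_i))/(2d) + ((d−1)/d) I_{n,0}(m e_i + m e_j)` (`i ≠ j`).
[cite: FitznerVanDerHofstad2016NoBLE, (3.34) p. 1071; (5.4), (5.7) p. 1091] -/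
theorem srwSqMom_one_single_eq {n : ℕ} (hd : 2 * n + 1 ≤ d) {i j : Fin d} (hij : i ≠ j) (m : ℤ) :
    srwSqMom d n (fun _ => (1 : ℝ)) (Pi.single i m)
      = (srwI d n 0 0 + srwI d n 0 (Pi.single i (2 * m))) / (2 * d)
        + ((d : ℝ) - 1) / d * srwI d n 0 (Pi.single i m + Pi.single j m) := by
  have h := srwSqMom_abs_Dhat_pow_even_single_eq hd 0 hij m
  simpa only [mul_zero, pow_zero] using h

/-- **`K_{n,2}` row input, m-uniform, `ℚ`-cast:** for `n ≥ 1`, `d ≥ 2n+1`, `i ≠ j`, every `|m| ≥ M` and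
rational bounds `I_{n,2}(0) ≤ A₀`, `I_{n,2}(2M e_i) ≤ A₂`, `I_{n,2}(M e_i + M e_j) ≤ A₁₁`:
`Sq^{|D̂|²}_n(m e_i) ≤ ((A₀ + A₂)/(2d) + ((d−1)/d) A₁₁ : ℚ)`.
[cite: FitznerVanDerHofstad2016NoBLE, (5.4), (5.7) p. 1091, Lemma 5.1 p. 1093] -/
theorem srwSqMom_abs_Dhat_sq_single_le_cast {n : ℕ} (hn : 1 ≤ n) (hd : 2 * n + 1 ≤ d) {i j : Fin d}
    (hij : i ≠ j) (M : ℕ) {m : ℤ} (hM : M ≤ m.natAbs) {A₀ A₂ A₁₁ : ℚ}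
    (h0 : srwI d n 2 0 ≤ (A₀ : ℝ)) (h2 : srwI d n 2 (Pi.single i (2 * (M : ℤ))) ≤ (A₂ : ℝ))
    (h11 : srwI d n 2 (Pi.single i (M : ℤ) + Pi.single j (M : ℤ)) ≤ (A₁₁ : ℝ)) :
    srwSqMom d n (fun k => |Dhat d k| ^ 2) (Pi.single i m)
      ≤ (((A₀ + A₂) / (2 * d) + ((d : ℚ) - 1) / d * A₁₁ : ℚ) : ℝ) := by
  have h := srwSqMom_abs_Dhat_pow_even_single_le_of_le hn hd 1 hij M hM
    (by simpa only [mul_one] using h0) (by simpa only [mul_one] using h2) (by simpa only [mul_one] using h11)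
  push_cast
  simpa only [mul_one] using h

/-- **`K`-row input with the unit weight (`Sq^{|D̂|⁰} = Sq^{1} = L_n`), m-uniform, `ℚ`-cast** (`n ≥ 1`,
`d ≥ 2n+1`, `i ≠ j`, `|m| ≥ M`; bounds on `I_{n,0}` at `0`, `2M e_i`, `M e_i + M e_j`).
[cite: FitznerVanDerHofstad2016NoBLE, (5.4), (5.7) p. 1091, Lemma 5.1 p. 1093] -/
theorem srwSqMom_abs_Dhat_pow_zero_single_le_cast {n : ℕ} (hn : 1 ≤ n) (hd : 2 * n + 1 ≤ d) {i j : Fin d}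
    (hij : i ≠ j) (M : ℕ) {m : ℤ} (hM : M ≤ m.natAbs) {B₀ B₂ B₁₁ : ℚ}
    (h0 : srwI d n 0 0 ≤ (B₀ : ℝ)) (h2 : srwI d n 0 (Pi.single i (2 * (M : ℤ))) ≤ (B₂ : ℝ))
    (h11 : srwI d n 0 (Pi.single i (M : ℤ) + Pi.single j (M : ℤ)) ≤ (B₁₁ : ℝ)) :
    srwSqMom d n (fun k => |Dhat d k| ^ 0) (Pi.single i m)
      ≤ (((B₀ + B₂) / (2 * d) + ((d : ℚ) - 1) / d * B₁₁ : ℚ) : ℝ) := by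
  have h := srwSqMom_abs_Dhat_pow_even_single_le_of_le hn hd 0 hij M hM
    (by simpa only [mul_zero] using h0) (by simpa only [mul_zero] using h2) (by simpa only [mul_zero] using h11)
  push_cast
  simpa only [mul_zero] using h

/-- **`U_{n,l}` row input (`l = 0`), m-uniform, `ℚ`-cast:** `Sq^{|D̂|⁰D̂^{sin}}_n(m e_i) ≤ (d⁻¹((B₀ + B₂)/(2d) + ((d−1)/d) B₁₁) : ℚ)`.
[cite: FitznerVanDerHofstad2016NoBLE, (3.38) p. 1071; (5.4), (5.7), (5.9) pp. 1091–1092, Lemma 5.1 p. 1093] -/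
theorem srwSqMom_abs_Dhat_pow_zero_mul_Dsin_single_le_cast {n : ℕ} (hn : 1 ≤ n) (hd : 2 * n + 1 ≤ d)
    {i j : Fin d} (hij : i ≠ j) (M : ℕ) {m : ℤ} (hM : M ≤ m.natAbs) {B₀ B₂ B₁₁ : ℚ}
    (h0 : srwI d n 0 0 ≤ (B₀ : ℝ)) (h2 : srwI d n 0 (Pi.single i (2 * (M : ℤ))) ≤ (B₂ : ℝ))
    (h11 : srwI d n 0 (Pi.single i (M : ℤ) + Pi.single j (M : ℤ)) ≤ (B₁₁ : ℝ)) :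
    srwSqMom d n (fun k => |Dhat d k| ^ 0 * Dsin d k) (Pi.single i m)
      ≤ ((1 / d * ((B₀ + B₂) / (2 * d) + ((d : ℚ) - 1) / d * B₁₁) : ℚ) : ℝ) := by
  have h := srwSqMom_abs_Dhat_pow_zero_single_le_cast hn hd hij M hM h0 h2 h11
  have hU := srwSqMom_abs_Dhat_pow_mul_Dsin_le hd 0 (Pi.single i m)
  have hd0 : (0 : ℝ) ≤ 1 / d := by positivity
  push_cast at h ⊢
  exact hU.trans (mul_le_mul_of_nonneg_left h hd0)

/-- **`U_{n,l}` row input (`l = 2`), m-uniform, `ℚ`-cast:** `Sq^{|D̂|²D̂^{sin}}_n(m e_i) ≤ (d⁻¹((A₀ + A₂)/(2d) + ((d−1)/d) A₁₁) : ℚ)`.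
[cite: FitznerVanDerHofstad2016NoBLE, (3.38) p. 1071; (5.4), (5.7), (5.9) pp. 1091–1092, Lemma 5.1 p. 1093] -/
theorem srwSqMom_abs_Dhat_sq_mul_Dsin_single_le_cast {n : ℕ} (hn : 1 ≤ n) (hd : 2 * n + 1 ≤ d)
    {i j : Fin d} (hij : i ≠ j) (M : ℕ) {m : ℤ} (hM : M ≤ m.natAbs) {A₀ A₂ A₁₁ : ℚ}
    (h0 : srwI d n 2 0 ≤ (A₀ : ℝ)) (h2 : srwI d n 2 (Pi.single i (2 * (M : ℤ))) ≤ (A₂ : ℝ))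
    (h11 : srwI d n 2 (Pi.single i (M : ℤ) + Pi.single j (M : ℤ)) ≤ (A₁₁ : ℝ)) :
    srwSqMom d n (fun k => |Dhat d k| ^ 2 * Dsin d k) (Pi.single i m)
      ≤ ((1 / d * ((A₀ + A₂) / (2 * d) + ((d : ℚ) - 1) / d * A₁₁) : ℚ) : ℝ) := by
  have h := srwSqMom_abs_Dhat_sq_single_le_cast hn hd hij M hM h0 h2 h11
  have hU := srwSqMom_abs_Dhat_pow_mul_Dsin_le hd 2 (Pi.single i m)
  have hd0 : (0 : ℝ) ≤ 1 / d := by positivity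
  push_cast at h ⊢
  exact hU.trans (mul_le_mul_of_nonneg_left h hd0)

/-! ### The `KM₂` row input at the axis nodes as plain seeds -/

/-- **`KM₂` row input as seeds:** for `d ≥ 2n+1`, `i ≠ j`, every `m`:
`Sq^{|D̂|⁰M̂²}_n(m e_i) ≤ [(I_{n,2}(0) + I_{n,2}(2me_i))/(2d) + ((d−1)/d) I_{n,2}(me_i + me_j)]
  + (4/d)[(I_{n,0}(0) + I_{n,0}(2me_i))/(2d) + ((d−1)/d) I_{n,0}(me_i + me_j)]`.
[cite: FitznerVanDerHofstad2016NoBLE, (3.34)–(3.37) p. 1071; §5.2 (5.4), (5.7), (5.9)–(5.10) pp. 1091–1092] -/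
theorem srwSqMom_Mhat_sq_single_le {n : ℕ} (hd : 2 * n + 1 ≤ d) {i j : Fin d} (hij : i ≠ j) (m : ℤ) :
    srwSqMom d n (fun k => |Dhat d k| ^ 0 * Mhat d k ^ 2) (Pi.single i m)
      ≤ ((srwI d n 2 0 + srwI d n 2 (Pi.single i (2 * m))) / (2 * d)
          + ((d : ℝ) - 1) / d * srwI d n 2 (Pi.single i m + Pi.single j m))
        + 4 / d * ((srwI d n 0 0 + srwI d n 0 (Pi.single i (2 * m))) / (2 * d)
          + ((d : ℝ) - 1) / d * srwI d n 0 (Pi.single i m + Pi.single j m)) := by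
  rw [← srwSqMom_abs_Dhat_sq_single_eq hd hij m, ← srwSqMom_one_single_eq hd hij m]
  exact srwSqMom_Mhat_sq_le hd (two_le_of_ne hij) (Pi.single i m)

/-- **`KM₂` row input, m-uniform, `ℚ`-cast:** for `n ≥ 1`, `d ≥ 2n+1`, `i ≠ j`, every `|m| ≥ M` and rational
bounds `I_{n,2}(0) ≤ A₀`, `I_{n,2}(2M e_i) ≤ A₂`, `I_{n,2}(M e_i + M e_j) ≤ A₁₁`, `I_{n,0}(0) ≤ B₀`,
`I_{n,0}(2M e_i) ≤ B₂`, `I_{n,0}(M e_i + M e_j) ≤ B₁₁`: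
`Sq^{|D̂|⁰M̂²}_n(m e_i) ≤ (((A₀ + A₂)/(2d) + ((d−1)/d) A₁₁) + (4/d)((B₀ + B₂)/(2d) + ((d−1)/d) B₁₁) : ℚ)` —
the `Shi` slot of `srwKM2_le_gset_encl_cast` / the `KM₂` class rows.
[cite: FitznerVanDerHofstad2016NoBLE, (3.34)–(3.37) p. 1071; §5.2 (5.4), (5.7), (5.9)–(5.10) pp. 1091–1092, Lemma 5.1 p. 1093] -/
theorem srwSqMom_Mhat_sq_single_le_cast {n : ℕ} (hn : 1 ≤ n) (hd : 2 * n + 1 ≤ d) {i j : Fin d}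
    (hij : i ≠ j) (M : ℕ) {m : ℤ} (hM : M ≤ m.natAbs) {A₀ A₂ A₁₁ B₀ B₂ B₁₁ : ℚ}
    (h0 : srwI d n 2 0 ≤ (A₀ : ℝ)) (h2 : srwI d n 2 (Pi.single i (2 * (M : ℤ))) ≤ (A₂ : ℝ))
    (h11 : srwI d n 2 (Pi.single i (M : ℤ) + Pi.single j (M : ℤ)) ≤ (A₁₁ : ℝ))
    (g0 : srwI d n 0 0 ≤ (B₀ : ℝ)) (g2 : srwI d n 0 (Pi.single i (2 * (M : ℤ))) ≤ (B₂ : ℝ))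
    (g11 : srwI d n 0 (Pi.single i (M : ℤ) + Pi.single j (M : ℤ)) ≤ (B₁₁ : ℝ)) :
    srwSqMom d n (fun k => |Dhat d k| ^ 0 * Mhat d k ^ 2) (Pi.single i m)
      ≤ ((((A₀ + A₂) / (2 * d) + ((d : ℚ) - 1) / d * A₁₁)
          + 4 / d * ((B₀ + B₂) / (2 * d) + ((d : ℚ) - 1) / d * B₁₁) : ℚ) : ℝ) := by
  have hK := srwSqMom_abs_Dhat_sq_single_le_cast hn hd hij M hM h0 h2 h11
  have hL := srwSqMom_abs_Dhat_pow_zero_single_le_cast hn hd hij M hM g0 g2 g11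
  rw [srwSqMom_abs_Dhat_pow_zero] at hL
  have h := srwSqMom_Mhat_sq_le hd (two_le_of_ne hij) (Pi.single i m)
  have hd0 : (0 : ℝ) ≤ 4 / d := by positivity
  push_cast at hK hL ⊢
  nlinarith [mul_le_mul_of_nonneg_left hL hd0]

end Literature.Probability.FitznerVanDerHofstad2017

end
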